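import Summits.ResolutionOfSingularities.ResolutionOfSingularities.Theses.UniversalCells
import Summits.ResolutionOfSingularities.ResolutionOfSingularities.Theorems.UniversalCellsDefs
import Summits.ResolutionOfSingularities.ResolutionOfSingularities.Theorems.UniversalCellsUniversality
import Summits.ResolutionOfSingularities.ResolutionOfSingularities.Theorems.UniversalCellsProductDescentBypass
import Summits.ResolutionOfSingularities.ResolutionOfSingularities.Theorems.UniversalCellsMatroidCellResChartReduction
import Literature.AlgebraicGeometry.Resolution.PrincipalizationToResolution
import HarnessLib

/-!
# Where the crux `MatroidCellRes` (stmt-ResolutionOfSingularities-15230) sits: the sandwich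
# `LocalRes(𝔽_p) ⇒ MatroidCellRes ⇒ StableLocalRes(𝔽_p)`, and `MatroidCellRes ⇔ LocalRes(𝔽_p)` modulo `ProductDescent`

Helper file (`--supports stmt-ResolutionOfSingularities-15230`; does not close the item). It is the
kernel-checked form of the route review's sentence "by Mnëv universality `MatroidCellRes` IS local
resolution of everything over `𝔽_p`, moved to one explicit family", for the pre-birth tribunal and
the redirect strategist's census (`Cruxes/MatroidCellRes/STRATEGY-CENSUS-r1.md`).

Write `LocalRes(𝔽_p)` for POINTWISE LOCAL RESOLVABILITY of every integral, separated, finite-type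
`𝔽_p`-scheme (verbatim the antecedent of the route's crux `LocalToGlobal`; by
`ProductDescent.Bypass.normStratumRes_iff_locRes` it is also the normalised-stratum hypothesis
`NSR`), and `StableLocalRes(𝔽_p)` for its STABLE form: every `y ∈ Y` has, for some `s`, an open
`W ⊆ 𝔸ˢ_Y` with a point over `y` and a resolvable open neighbourhood of that point in `W`
(resolution up to an affine-space factor). Then, sorry-free:

* `matroidCellRes_of_locRes` : `LocalRes(𝔽_p) → MatroidCellRes` — an integral `W` open-immersed in a
  partial matroid stratum is itself an integral separated finite-type `𝔽_p`-scheme;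
* `matroidCellRes_of_normStratumRes` : `NSR → MatroidCellRes` (via the bypass);
* `stableLocRes_of_matroidCellRes` : `MatroidCellRes → StableLocalRes(𝔽_p)` — by the PROVED crux
  `Universality` (`UniversalCells.Universality_proof`, Mnëv–Lafforgue–Lee–Vakil): every point of
  every integral finite-type `𝔽_p`-scheme lies under a point of an integral open of a stratum
  inside some `𝔸ˢ_Y`, which `MatroidCellRes` resolves locally. So ANY proof of the crux resolves
  every finite-type singularity over `𝔽_p` up to a factor `𝔸ˢ`, in every dimension — in
  particular in the open range `dim ≥ 4` (`Literature.Barriers.ResolutionOfSingularities.DimensionFourFrontier`);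
* `locRes_of_matroidCellRes_of_productDescent`, `matroidCellRes_iff_locRes_of_productDescent` :
  modulo the route's own rank-3 crux `ProductDescent` (descent of local resolvability along
  `𝔸ˢ_Y → Y`), `MatroidCellRes ↔ LocalRes(𝔽_p)`;
* `locRes_of_resolutionOfSingularities` : the summit gives `LocalRes(𝔽_p)` (hence the crux, by
  `matroidCellRes_of_locRes`; the composite is deliberately not stated as one theorem here — a
  `summit → item` theorem is the disprover's `Cruxes/MatroidCellRes/Disproof.lean`
  `matroidCellRes_of_summit`).

Reading for the tribunal (T1): `LocalRes(𝔽_p) ⇒ MatroidCellRes ⇒ StableLocalRes(𝔽_p)`; the two ends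
differ exactly by descent of resolvability along affine-space (equivalently split-torus) factors,
which is `ProductDescent` / the torus-slice step of `Cruxes/ProductDescent/REPAIR.md` — open as an
existence statement, automatic for Hu's torus-equivariant tower. No statement in this file is new
mathematics; all are compositions of landed theorems. [cite: LeeVakil2012, Thm. 1.1;
Lafforgue2003, Thm. I.14; Hu2021, Thms. 9.2–9.4]
-/

set_option linter.dupNamespace false -- mandated namespace of this single-conjunct summit

noncomputable section

open CategoryTheory AlgebraicGeometry TopologicalSpace Literature.AlgebraicGeometry.Resolution
open Summit.ResolutionOfSingularities.ResolutionOfSingularities.Theses.UniversalCells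
  (MatroidCellRes ProductDescent LocalToGlobal PrimeFieldThesis Universality)
open Summit.ResolutionOfSingularities.ResolutionOfSingularities.Theorems.UniversalCells

namespace Summit.ResolutionOfSingularities.ResolutionOfSingularities.Theorems.MatroidCellRes

/-! ## `LocalRes(𝔽_p) ⇒ MatroidCellRes` -/

/-- **Pointwise local resolvability over `𝔽_p` implies the crux.** An integral scheme `W`
open-immersed in the partial matroid stratum `P(p, m, Γ₊, Γ₀)` is an integral, separated,
finite-type `𝔽_p`-scheme (open in an affine scheme of finite type over `𝔽_p`, whose space is
Noetherian), so `LocalRes(𝔽_p)` — the antecedent of `LocalToGlobal`, verbatim — applies to it.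
[folklore] -/
theorem matroidCellRes_of_locRes :
    (∀ (p : ℕ), p.Prime → ∀ (X : AlgebraicGeometry.Scheme.{0})
      (f : X ⟶ AlgebraicGeometry.Spec (.of (ZMod p))),
      AlgebraicGeometry.IsSeparated f → AlgebraicGeometry.LocallyOfFiniteType f →
      AlgebraicGeometry.QuasiCompact f → AlgebraicGeometry.IsIntegral X →
      ∀ x : X, ∃ U : X.Opens, x ∈ U ∧
        Literature.AlgebraicGeometry.Resolution.Scheme.HasResolution (U : AlgebraicGeometry.Scheme.{0})) →
    Summit.ResolutionOfSingularities.ResolutionOfSingularities.Theses.UniversalCells.MatroidCellRes := by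
  intro hloc p hp m Γp Γ0 M I W i hi hW w
  haveI : Fact p.Prime := ⟨hp⟩
  haveI : IsOpenImmersion i := hi
  haveI : IsIntegral W := hW
  -- the structure morphism of the stratum is locally of finite type
  haveI hft : LocallyOfFiniteType (Spec.map (CommRingCat.ofHom
      (algebraMap (ZMod p) (StratumRing p m Γp Γ0)))) :=
    locallyOfFiniteType_away p m (minorIdeal p m Γ0)
      (Ideal.Quotient.mk (minorIdeal p m Γ0) (∏ u ∈ Γp, ((tautMatrix p m).submatrix id u).det))
  let f : W ⟶ Spec (.of (ZMod p)) :=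
    i ≫ Spec.map (CommRingCat.ofHom (algebraMap (ZMod p) (StratumRing p m Γp Γ0)))
  haveI : LocallyOfFiniteType f := inferInstance
  haveI : IsSeparated f := inferInstance
  haveI : NoetherianSpace W := i.isOpenEmbedding.isInducing.noetherianSpace
  haveI : QuasiCompact f := inferInstance
  exact hloc p hp W f ‹_› ‹_› ‹_› ‹_› w

/-- **The normalised-stratum hypothesis implies the crux**: `NSR ⇔ LocalRes(𝔽_p)`
(`ProductDescent.Bypass.normStratumRes_iff_locRes`) and `LocalRes(𝔽_p) ⇒ MatroidCellRes`.
[folklore] -/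
theorem matroidCellRes_of_normStratumRes
    (hN : ∀ p : ℕ, p.Prime → ∀ (N : ℕ) (Eadd Emul : Finset (Fin N × Fin N × Fin N))
      (Eone : Finset (Fin N)),
      IsDomain (NormRing p (Kol N) (dRow N) (config N Eadd Emul Eone)) →
      ∀ x : Spec (.of (NormRing p (Kol N) (dRow N) (config N Eadd Emul Eone))),
        ∃ V : (Spec (.of (NormRing p (Kol N) (dRow N) (config N Eadd Emul Eone)))).Opens,
          x ∈ V ∧ Scheme.HasResolution (V : Scheme.{0})) :
    MatroidCellRes :=
  matroidCellRes_of_locRes (ProductDescent.Bypass.normStratumRes_iff_locRes.mp hN)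

/-! ## `MatroidCellRes ⇒ StableLocalRes(𝔽_p)` -/

/-- **The crux implies STABLE local resolution of every integral finite-type `𝔽_p`-scheme.**
For `Y` integral, separated, of finite type over `𝔽_p` and `y ∈ Y`, the proved crux
`Universality` gives `s`, an integral `W`, an open immersion `j : W → 𝔸ˢ_Y`, an open immersion of
`W` into a partial matroid stratum, and `w ∈ W` over `y`; `MatroidCellRes` gives a resolvable
open `W' ∋ w`. Hence every finite-type singularity over `𝔽_p`, of every dimension, is resolved
up to a factor `𝔸ˢ` by any proof of the crux. [cite: LeeVakil2012, Thm. 1.1; Lafforgue2003,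
Thm. I.14] -/
theorem stableLocRes_of_matroidCellRes :
    Summit.ResolutionOfSingularities.ResolutionOfSingularities.Theses.UniversalCells.MatroidCellRes →
    ∀ (p : ℕ), p.Prime → ∀ (Y : AlgebraicGeometry.Scheme.{0})
      (f : Y ⟶ AlgebraicGeometry.Spec (.of (ZMod p))),
      AlgebraicGeometry.IsSeparated f → AlgebraicGeometry.LocallyOfFiniteType f →
      AlgebraicGeometry.QuasiCompact f → AlgebraicGeometry.IsIntegral Y →
      ∀ y : Y, ∃ (s : ℕ) (W : AlgebraicGeometry.Scheme.{0})
        (j : W ⟶ AlgebraicGeometry.AffineSpace (Fin s) Y) (w : W) (W' : W.Opens),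
        AlgebraicGeometry.IsOpenImmersion j ∧ AlgebraicGeometry.IsIntegral W ∧
          (CategoryTheory.over (AlgebraicGeometry.AffineSpace (Fin s) Y) Y).base (j.base w) = y ∧
          w ∈ W' ∧
          Literature.AlgebraicGeometry.Resolution.Scheme.HasResolution (W' : AlgebraicGeometry.Scheme.{0}) := by
  intro hC p hp Y f hs hl hq hY y
  obtain ⟨m, Γp, Γ0, s, W, j, w, i, hj, hi, hW, hy⟩ := Universality_proof p hp Y f hs hl hq hY y
  obtain ⟨W', hw', hres⟩ := hC p hp m Γp Γ0 W i hi hW w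
  exact ⟨s, W, j, w, W', hj, hW, hy, hw', hres⟩

/-! ## Modulo `ProductDescent`, the crux IS `LocalRes(𝔽_p)` -/

/-- **`MatroidCellRes ∧ ProductDescent ⇒ LocalRes(𝔽_p)`** (the inner block of the route's
deciding theorem `UniversalCells.closes`, isolated): universality, the crux, then descent along
`𝔸ˢ_Y → Y`. [folklore] -/
theorem locRes_of_matroidCellRes_of_productDescent (hC : MatroidCellRes) (hD : ProductDescent)
    (p : ℕ) (hp : p.Prime) (Y : Scheme.{0}) (f : Y ⟶ Spec (.of (ZMod p))) (hs : IsSeparated f)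
    (hl : LocallyOfFiniteType f) (hq : QuasiCompact f) (hY : IsIntegral Y) (y : Y) :
    ∃ U : Y.Opens, y ∈ U ∧ Scheme.HasResolution (U : Scheme.{0}) := by
  obtain ⟨m, Γp, Γ0, s, W, j, w, i, hj, hi, hW, hy⟩ := Universality_proof p hp Y f hs hl hq hY y
  obtain ⟨W', hw', hres⟩ := hC p hp m Γp Γ0 W i hi hW w
  obtain ⟨U, hU, hresU⟩ := hD p hp Y f hs hl hq hY s W j hj w ⟨W', hw', hres⟩
  exact ⟨U, hy ▸ hU, hresU⟩

/-- **Modulo the route's rank-3 crux `ProductDescent`, `MatroidCellRes ↔ LocalRes(𝔽_p)`** (the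
antecedent of `LocalToGlobal`; equivalently `NSR`, by `normStratumRes_iff_locRes`). This is the
precise sense in which the crux is "local resolution of everything over `𝔽_p` in a matroid
costume": the costume is removed by universality (proved) in one direction and is transparent
in the other; only the affine-factor descent separates them. [folklore] -/
theorem matroidCellRes_iff_locRes_of_productDescent :
    Summit.ResolutionOfSingularities.ResolutionOfSingularities.Theses.UniversalCells.ProductDescent →
    (Summit.ResolutionOfSingularities.ResolutionOfSingularities.Theses.UniversalCells.MatroidCellRes ↔
      ∀ (p : ℕ), p.Prime → ∀ (X : AlgebraicGeometry.Scheme.{0})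
        (f : X ⟶ AlgebraicGeometry.Spec (.of (ZMod p))),
        AlgebraicGeometry.IsSeparated f → AlgebraicGeometry.LocallyOfFiniteType f →
        AlgebraicGeometry.QuasiCompact f → AlgebraicGeometry.IsIntegral X →
        ∀ x : X, ∃ U : X.Opens, x ∈ U ∧
          Literature.AlgebraicGeometry.Resolution.Scheme.HasResolution (U : AlgebraicGeometry.Scheme.{0})) :=
  fun hD =>
  ⟨fun hC p hp X f hs hl hq hX x => locRes_of_matroidCellRes_of_productDescent hC hD p hp X f hs hl hq hX x,
    matroidCellRes_of_locRes⟩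

/-! ## The summit end of the sandwich -/

/-- **The summit gives `LocalRes(𝔽_p)`** (take `U = X`): so the chain reads
`ResolutionOfSingularities ⇒ LocalRes(𝔽_p) ⇒ MatroidCellRes ⇒ StableLocalRes(𝔽_p)`, every arrow
kernel-checked; no arrow is known to reverse short of `ProductDescent` (middle) or the summit's
`LocalToGlobal` + descent rungs (left). [folklore] -/
theorem locRes_of_resolutionOfSingularities (hS : _root_.ResolutionOfSingularities) (p : ℕ)
    (hp : p.Prime) (X : Scheme.{0}) (f : X ⟶ Spec (.of (ZMod p))) (hs : IsSeparated f)
    (hl : LocallyOfFiniteType f) (hq : QuasiCompact f) (hX : IsIntegral X) (x : X) :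
    ∃ U : X.Opens, x ∈ U ∧ Scheme.HasResolution (U : Scheme.{0}) := by
  haveI : Fact p.Prime := ⟨hp⟩
  haveI := hX
  have hres : Scheme.HasResolution X := hS p hp (ZMod p) X f hs hl hq inferInstance
  exact ⟨⊤, trivial, hres.restrict ⊤⟩

end Summit.ResolutionOfSingularities.ResolutionOfSingularities.Theorems.MatroidCellRes

end
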